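import Literature.Probability.LatticeModels.PlaneRotatorComponentCone
import HarnessLib

/-!
# The component correlation inequalities of the ferromagnetic plane rotator
# (Dunlop 1976 / Kunz–Pfister–Vuillermot 1976 / Bricmont–Fontaine–Landau 1977, Theorem A2):
# `⟨s_A s_B⟩ ≥ ⟨s_A⟩⟨s_B⟩`, `⟨t_A t_B⟩ ≥ ⟨t_A⟩⟨t_B⟩`, `0 ≤ ⟨s_A t_B⟩ ≤ ⟨s_A⟩⟨t_B⟩`,
# and the decoupling of two bond currents `|⟨sin ∇θ_b sin ∇θ_{b'}⟩| ≤ 2(GG + GG)`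

Topic `Literature/Probability/LatticeModels`. Model: the plane rotator (classical XY model) with general
FERROMAGNETIC bond couplings `J_a ≥ 0` on a finite bond system `G : BondSystem V ι` — Gibbs weight
`w_J(θ) = exp(∑_a J_a cos(θ_{tgt a} − θ_{src a}))` on `U(1)^V` with the Haar probability measure, expectation
`⟨·⟩_J = BondSystem.expectJ` (vocabulary of `PlaneRotatorJensenRotationBound.lean`). Components
`s_i = cos θ_i` (`spinRe`), `t_i = sin θ_i` (`spinIm`), products `s_A = ∏_{i∈A} cos θ_i` (`cosProd A`),
`t_B = ∏_{i∈B} sin θ_i` (`sinProd B`) over multisets of sites.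

## Contents (everything PROVED; no named fact)

* §1 The duplicated weight `w_J(φψ) w_J(φψ̄) = exp(2∑_a J_a cos∇φ_a cos∇ψ_a)` lies (after `expTrunc`) in the
  component cone of the toolkit file; the abstract covariance sign lemmas `integral_mul_mul_weightJ_mul_le/ge`:
  if `∓(f_− g_−)` lies in the cone then `(∫ fg w)(∫ w) ≶ (∫ f w)(∫ g w)` (Ginibre duplication
  `2[(∫fgw)(∫w) − (∫fw)(∫gw)] = ∫∫ f_− g_− w(φψ)w(φψ̄) dφ dψ`, tree `integral_sub_mul_sub_mul`,
  `integral_comp_dupHom`).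
* §2 **Theorem A2 of Bricmont–Fontaine–Landau** for the fixed-length plane rotator with pair interactions:
  `expectJ_cosProd_mul_cosProd_ge` (`⟨s_A s_B⟩ ≥ ⟨s_A⟩⟨s_B⟩`), `expectJ_sinProd_mul_sinProd_ge`
  (`⟨t_A t_B⟩ ≥ ⟨t_A⟩⟨t_B⟩`), `expectJ_cosProd_mul_sinProd_nonneg` and `expectJ_cosProd_mul_sinProd_le`
  (**`0 ≤ ⟨s_A t_B⟩ ≤ ⟨s_A⟩⟨t_B⟩`**: the `x`- and `y`-components are positively correlated among themselves and
  NEGATIVELY correlated with each other). Originals: Dunlop 1976 (CMP 49), Kunz–Pfister–Vuillermot 1976,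
  Bricmont 1976; modern account Benassi–Lees–Ueltschi 2017, Thm 1.
* §3 Two sites: `⟨cos θ_x cos θ_y⟩`, `⟨sin θ_x sin θ_y⟩ ∈ [0, ⟨cos(θ_x − θ_y)⟩]`.
* §4 **Decoupling of two bond currents**: for any four sites,
  `|⟨sin(θ_{a'} − θ_a) sin(θ_{c'} − θ_c)⟩_J| ≤ 2(G(a,c)G(a',c') + G(a,c')G(a',c))`, `G(x,y) = ⟨cos(θ_x − θ_y)⟩_J`
  (`abs_expectJ_imChar_mul_imChar_le`): expand the sines in components, bound the four `⟨s_A t_B⟩` terms by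
  A2. This is the input that makes current–current correlations across two distant cuts of a torus as small as
  the square of the two-point function (consumed by `PlaneRotatorStiffnessHighTemperatureLieb.lean`).

## References

* J. Bricmont, J.-R. Fontaine, L. J. Landau, Comm. Math. Phys. 56 (1977) 281–296, Appendix, Theorem A2
  (inequalities (A2), (A3)) and Theorem A3 (duplicate-variable proof). [BricmontFontaineLandau1977]
* F. Dunlop, Comm. Math. Phys. 49 (1976) 247–256. [Dunlop1976]
* H. Kunz, C.-E. Pfister, P.-A. Vuillermot, J. Phys. A 9 (1976) 1673–1683. [KunzPfisterVuillermot1976]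
* C. Benassi, B. Lees, D. Ueltschi, *Correlation inequalities for classical and quantum XY models*, in: Advances in
  Quantum Mechanics (Springer INdAM 18, 2017), Theorem 1 (classical part). [BenassiLeesUeltschi2017]

## What this is not

Fixed-length plane rotators with PAIR interactions `J_a cos(θ_{tgt a} − θ_{src a})` only (no fields, no
multi-body terms, no general single-spin measure «Condition A»); nothing about electrons or any quantum model.
-/

noncomputable section

open MeasureTheory Filter Finset
open scoped BigOperators Topology ComplexConjugate

namespace Literature.Probability.LatticeModels

namespace BondSystem

open PlaneRotator

variable {V ι : Type*} [Fintype V] [DecidableEq V] [Fintype ι] (G : BondSystem V ι)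

/-! ## §1 The duplicated weight and the covariance sign lemmas -/

section Weight

omit [Fintype ι] in
/-- The bond energy `cos(θ_{tgt a} − θ_{src a})` of the first duplicate lies in the component cone
(`cos(θ_y − θ_x) = cos θ_x cos θ_y + sin θ_x sin θ_y`). [cite: BricmontFontaineLandau1977, Appendix, proof of Thm A3] -/
theorem isCompPos_reChar_bondChar_fst (a : ι) :
    IsCompPos (fun z : (V → Circle) × (V → Circle) => reChar (G.bondChar a) z.1) := by
  have h : (fun z : (V → Circle) × (V → Circle) => reChar (G.bondChar a) z.1) = fun z =>
      spinRe (G.src a) z.1 * spinRe (G.tgt a) z.1 + spinIm (G.src a) z.1 * spinIm (G.tgt a) z.1 :=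
    funext fun z => reChar_diffChar_eq_components _ _ _
  rw [h]
  exact (isCompPos_fst ((IsCompMonomial.spinRe _).mul (IsCompMonomial.spinRe _))).add
    (isCompPos_fst ((IsCompMonomial.spinIm _).mul (IsCompMonomial.spinIm _)))

omit [Fintype ι] in
/-- The bond energy of the second duplicate lies in the component cone. [cite: BricmontFontaineLandau1977, Appendix, proof of Thm A3] -/
theorem isCompPos_reChar_bondChar_snd (a : ι) :
    IsCompPos (fun z : (V → Circle) × (V → Circle) => reChar (G.bondChar a) z.2) := by
  have h : (fun z : (V → Circle) × (V → Circle) => reChar (G.bondChar a) z.2) = fun z =>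
      spinRe (G.src a) z.2 * spinRe (G.tgt a) z.2 + spinIm (G.src a) z.2 * spinIm (G.tgt a) z.2 :=
    funext fun z => reChar_diffChar_eq_components _ _ _
  rw [h]
  exact (isCompPos_snd ((IsCompMonomial.spinRe _).mul (IsCompMonomial.spinRe _))).add
    (isCompPos_snd ((IsCompMonomial.spinIm _).mul (IsCompMonomial.spinIm _)))

/-- For `J ≥ 0` the Hamiltonian `∑_a J_a cos ∇θ_a` of the first duplicate lies in the cone. [cite: BricmontFontaineLandau1977, Appendix, proof of Thm A3 (positive coefficients)] -/
theorem isCompPos_hamiltonian_fst {J : ι → ℝ} (hJ : ∀ a, 0 ≤ J a) :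
    IsCompPos (fun z : (V → Circle) × (V → Circle) => ginibreHamiltonian G.bondChar J z.1) := by
  unfold ginibreHamiltonian
  exact IsCompPos.sum fun a _ => (G.isCompPos_reChar_bondChar_fst a).const_mul (hJ a)

/-- For `γ ≥ 0` the duplicated interaction `∑_a γ_a cos∇φ_a cos∇ψ_a` (tree `reKernel`) lies in the cone.
[cite: BricmontFontaineLandau1977, Appendix, proof of Thm A3 (positive coefficients)] -/
theorem isCompPos_reKernel {γ : ι → ℝ} (hγ : ∀ a, 0 ≤ γ a) :
    IsCompPos (reKernel G.bondChar γ : (V → Circle) × (V → Circle) → ℝ) := by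
  unfold reKernel
  exact IsCompPos.sum fun a _ =>
    ((G.isCompPos_reChar_bondChar_fst a).mul (G.isCompPos_reChar_bondChar_snd a)).const_mul (hγ a)

omit [Fintype V] [DecidableEq V] in
/-- **The duplicated weight**: `w_J(φψ) · w_J(φψ̄) = exp(∑_a 2J_a cos∇φ_a cos∇ψ_a)` (Ginibre:
`cos(α+β) + cos(α−β) = 2 cos α cos β` bondwise). [cite: Ginibre1970, main theorem (duplication)] -/
theorem weightJ_mul_weightJ_dup (J : ι → ℝ) (z : (V → Circle) × (V → Circle)) :
    G.weightJ J (z.1 * z.2) * G.weightJ J (z.1 * z.2⁻¹) = Real.exp (reKernel G.bondChar (fun a => 2 * J a) z) := by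
  rw [weightJ, weightJ, ginibreWeight, ginibreWeight, ← Real.exp_add, ginibreHamiltonian_mul_add]
  congr 1
  simp only [reKernel, Finset.mul_sum]
  exact Finset.sum_congr rfl fun a _ => by ring

variable [MeasurableSpace Circle] [BorelSpace Circle]

/-- **Covariance sign lemma, upper**: if `−(f_− g_−)` lies in the component cone then
`(∫ f g w_J)(∫ w_J) ≤ (∫ f w_J)(∫ g w_J)` (`J ≥ 0`), since
`2[(∫ f g w)(∫ w) − (∫ f w)(∫ g w)] = ∫∫ f_− g_− w(φψ) w(φψ̄) dφ dψ ≤ 0`.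
[cite: BricmontFontaineLandau1977, Appendix, proof of Thm A3 (the integral (*) is ≥ 0)] -/
theorem integral_mul_mul_weightJ_mul_le {J : ι → ℝ} (hJ : ∀ a, 0 ≤ J a) {f g : (V → Circle) → ℝ}
    (hf : Continuous f) (hg : Continuous g) (h : IsCompPos (fun z => -(dupMinus f z * dupMinus g z))) :
    (∫ θ, f θ * g θ * G.weightJ J θ ∂torusHaar V) * G.partitionFnJ J ≤
      (∫ θ, f θ * G.weightJ J θ ∂torusHaar V) * (∫ θ, g θ * G.weightJ J θ ∂torusHaar V) := by
  have hw := G.continuous_weightJ J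
  have key := integral_sub_mul_sub_mul (torusHaar V) hf hg hw
  have hF : Continuous fun p : (V → Circle) × (V → Circle) =>
      (f p.1 - f p.2) * (g p.1 - g p.2) * (G.weightJ J p.1 * G.weightJ J p.2) := by fun_prop
  have hdup := integral_comp_dupHom (torusHaar V) surjective_mul_self_torus hF
  have hpt : ∀ z : (V → Circle) × (V → Circle),
      (f (dupHom z).1 - f (dupHom z).2) * (g (dupHom z).1 - g (dupHom z).2) *
          (G.weightJ J (dupHom z).1 * G.weightJ J (dupHom z).2) =
        -( -(dupMinus f z * dupMinus g z) * Real.exp (reKernel G.bondChar (fun a => 2 * J a) z)) := by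
    intro z
    rw [dupHom_apply, weightJ_mul_weightJ_dup]
    simp only [dupMinus]
    ring
  simp_rw [hpt] at hdup
  rw [integral_neg] at hdup
  have hnn : 0 ≤ ∫ z, -(dupMinus f z * dupMinus g z) * Real.exp (reKernel G.bondChar (fun a => 2 * J a) z)
      ∂((torusHaar V).prod (torusHaar V)) :=
    h.integral_mul_exp_nonneg (G.isCompPos_reKernel fun a => by have := hJ a; positivity)
  have hle : (∫ x, f x * (G.weightJ J x * g x) ∂torusHaar V) * (∫ x, G.weightJ J x ∂torusHaar V) -
      (∫ x, f x * G.weightJ J x ∂torusHaar V) * (∫ x, G.weightJ J x * g x ∂torusHaar V) ≤ 0 := by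
    linarith
  have e1 : (∫ x, f x * (G.weightJ J x * g x) ∂torusHaar V) = ∫ θ, f θ * g θ * G.weightJ J θ ∂torusHaar V :=
    integral_congr_ae (ae_of_all _ fun θ => by ring)
  have e2 : (∫ x, G.weightJ J x * g x ∂torusHaar V) = ∫ θ, g θ * G.weightJ J θ ∂torusHaar V :=
    integral_congr_ae (ae_of_all _ fun θ => by ring)
  rw [e1, e2] at hle
  rw [partitionFnJ]
  linarith

/-- **Covariance sign lemma, lower**: if `f_− g_−` lies in the component cone then
`(∫ f w_J)(∫ g w_J) ≤ (∫ f g w_J)(∫ w_J)` (`J ≥ 0`). [cite: BricmontFontaineLandau1977, Appendix, proof of Thm A3] -/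
theorem integral_mul_mul_weightJ_mul_ge {J : ι → ℝ} (hJ : ∀ a, 0 ≤ J a) {f g : (V → Circle) → ℝ}
    (hf : Continuous f) (hg : Continuous g) (h : IsCompPos (fun z => dupMinus f z * dupMinus g z)) :
    (∫ θ, f θ * G.weightJ J θ ∂torusHaar V) * (∫ θ, g θ * G.weightJ J θ ∂torusHaar V) ≤
      (∫ θ, f θ * g θ * G.weightJ J θ ∂torusHaar V) * G.partitionFnJ J := by
  have hw := G.continuous_weightJ J
  have key := integral_sub_mul_sub_mul (torusHaar V) hf hg hw
  have hF : Continuous fun p : (V → Circle) × (V → Circle) =>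
      (f p.1 - f p.2) * (g p.1 - g p.2) * (G.weightJ J p.1 * G.weightJ J p.2) := by fun_prop
  have hdup := integral_comp_dupHom (torusHaar V) surjective_mul_self_torus hF
  have hpt : ∀ z : (V → Circle) × (V → Circle),
      (f (dupHom z).1 - f (dupHom z).2) * (g (dupHom z).1 - g (dupHom z).2) *
          (G.weightJ J (dupHom z).1 * G.weightJ J (dupHom z).2) =
        dupMinus f z * dupMinus g z * Real.exp (reKernel G.bondChar (fun a => 2 * J a) z) := by
    intro z
    rw [dupHom_apply, weightJ_mul_weightJ_dup]
    simp only [dupMinus]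
  simp_rw [hpt] at hdup
  have hnn : 0 ≤ ∫ z, dupMinus f z * dupMinus g z * Real.exp (reKernel G.bondChar (fun a => 2 * J a) z)
      ∂((torusHaar V).prod (torusHaar V)) :=
    h.integral_mul_exp_nonneg (G.isCompPos_reKernel fun a => by have := hJ a; positivity)
  have e1 : (∫ x, f x * (G.weightJ J x * g x) ∂torusHaar V) = ∫ θ, f θ * g θ * G.weightJ J θ ∂torusHaar V :=
    integral_congr_ae (ae_of_all _ fun θ => by ring)
  have e2 : (∫ x, G.weightJ J x * g x ∂torusHaar V) = ∫ θ, g θ * G.weightJ J θ ∂torusHaar V :=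
    integral_congr_ae (ae_of_all _ fun θ => by ring)
  rw [e1, e2] at key
  rw [partitionFnJ]
  linarith

/-- **Griffiths' first inequality in components**: if `θ ↦ f(θ)` (as a function of the first duplicate) lies in
the component cone — e.g. any product of components — then `0 ≤ ∫ f w_J` for `J ≥ 0`.
[cite: BricmontFontaineLandau1977, Appendix Thm A2 (A3), lower bound] -/
theorem integral_mul_weightJ_nonneg {J : ι → ℝ} (hJ : ∀ a, 0 ≤ J a) {f : (V → Circle) → ℝ}
    (h : IsCompPos (fun z : (V → Circle) × (V → Circle) => f z.1)) :
    0 ≤ ∫ θ, f θ * G.weightJ J θ ∂torusHaar V := by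
  have hnn := h.integral_mul_exp_nonneg (G.isCompPos_hamiltonian_fst hJ)
  have hprod := integral_prod_mul (μ := torusHaar V) (ν := torusHaar V)
    (fun θ => f θ * G.weightJ J θ) (fun _ : V → Circle => (1 : ℝ))
  simp only [mul_one, integral_const, probReal_univ, smul_eq_mul] at hprod
  have e : (fun z : (V → Circle) × (V → Circle) => f z.1 * Real.exp (ginibreHamiltonian G.bondChar J z.1)) =
      fun z => f z.1 * G.weightJ J z.1 := rfl
  rw [e, hprod] at hnn
  exact hnn

end Weight

/-! ## §2 Theorem A2: `⟨s_A s_B⟩ ≥ ⟨s_A⟩⟨s_B⟩`, `⟨t_A t_B⟩ ≥ ⟨t_A⟩⟨t_B⟩`, `0 ≤ ⟨s_A t_B⟩ ≤ ⟨s_A⟩⟨t_B⟩` -/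

section TheoremA2

variable [MeasurableSpace Circle] [BorelSpace Circle] {J : ι → ℝ}

omit [DecidableEq V] in
/-- From the cleared-denominator form to expectations: `(∫fgw)Z ≤ (∫fw)(∫gw) ⇒ ⟨fg⟩ ≤ ⟨f⟩⟨g⟩`. [cite: BricmontFontaineLandau1977, Appendix Thm A2 — plumbing] -/
private theorem expectJ_mul_le_of_integral (J : ι → ℝ) {f g : (V → Circle) → ℝ}
    (h : (∫ θ, f θ * g θ * G.weightJ J θ ∂torusHaar V) * G.partitionFnJ J ≤
      (∫ θ, f θ * G.weightJ J θ ∂torusHaar V) * (∫ θ, g θ * G.weightJ J θ ∂torusHaar V)) :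
    G.expectJ J (fun θ => f θ * g θ) ≤ G.expectJ J f * G.expectJ J g := by
  have hZ := G.partitionFnJ_pos J
  rw [expectJ_eq, expectJ_eq, expectJ_eq, div_mul_div_comm, div_le_div_iff₀ hZ (mul_pos hZ hZ)]
  have := mul_le_mul_of_nonneg_right h hZ.le
  linarith

omit [DecidableEq V] in
/-- From the cleared-denominator form to expectations: `(∫fw)(∫gw) ≤ (∫fgw)Z ⇒ ⟨f⟩⟨g⟩ ≤ ⟨fg⟩`. [cite: BricmontFontaineLandau1977, Appendix Thm A2 — plumbing] -/
private theorem expectJ_mul_ge_of_integral (J : ι → ℝ) {f g : (V → Circle) → ℝ}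
    (h : (∫ θ, f θ * G.weightJ J θ ∂torusHaar V) * (∫ θ, g θ * G.weightJ J θ ∂torusHaar V) ≤
      (∫ θ, f θ * g θ * G.weightJ J θ ∂torusHaar V) * G.partitionFnJ J) :
    G.expectJ J f * G.expectJ J g ≤ G.expectJ J (fun θ => f θ * g θ) := by
  have hZ := G.partitionFnJ_pos J
  rw [expectJ_eq, expectJ_eq, expectJ_eq, div_mul_div_comm, div_le_div_iff₀ (mul_pos hZ hZ) hZ]
  have := mul_le_mul_of_nonneg_right h hZ.le
  linarith

/-- **(A2), `x`-components: `⟨s_A s_B⟩_J ≥ ⟨s_A⟩_J ⟨s_B⟩_J`** for the ferromagnetic plane rotator (`J ≥ 0`;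
`s_A = ∏_{i∈A} cos θ_i`, multisets `A, B`). [cite: BricmontFontaineLandau1977, Appendix Thm A2 (A2)] -/
theorem expectJ_cosProd_mul_cosProd_ge (hJ : ∀ a, 0 ≤ J a) (A B : Multiset V) :
    G.expectJ J (cosProd A) * G.expectJ J (cosProd B) ≤ G.expectJ J (fun θ => cosProd A θ * cosProd B θ) := by
  refine G.expectJ_mul_ge_of_integral J (G.integral_mul_mul_weightJ_mul_ge hJ (continuous_cosProd A)
    (continuous_cosProd B) ?_)
  have h := (isCompPos_dup_cosProd A).2.mul (isCompPos_dup_cosProd B).2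
  simp only [neg_mul_neg] at h
  exact h

/-- **(A2), `y`-components: `⟨t_A t_B⟩_J ≥ ⟨t_A⟩_J ⟨t_B⟩_J`** (`J ≥ 0`; `t_B = ∏_{i∈B} sin θ_i`).
[cite: BricmontFontaineLandau1977, Appendix Thm A2 (A2) (by the symmetry s ↔ t of the isotropic model)] -/
theorem expectJ_sinProd_mul_sinProd_ge (hJ : ∀ a, 0 ≤ J a) (A B : Multiset V) :
    G.expectJ J (sinProd A) * G.expectJ J (sinProd B) ≤ G.expectJ J (fun θ => sinProd A θ * sinProd B θ) :=
  G.expectJ_mul_ge_of_integral J (G.integral_mul_mul_weightJ_mul_ge hJ (continuous_sinProd A)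
    (continuous_sinProd B) ((isCompPos_dup_sinProd A).2.mul (isCompPos_dup_sinProd B).2))

/-- **(A3), lower: `0 ≤ ⟨s_A t_B⟩_J`** (Griffiths' first inequality in components, `J ≥ 0`).
[cite: BricmontFontaineLandau1977, Appendix Thm A2 (A3)] -/
theorem expectJ_cosProd_mul_sinProd_nonneg (hJ : ∀ a, 0 ≤ J a) (A B : Multiset V) :
    0 ≤ G.expectJ J (fun θ => cosProd A θ * sinProd B θ) := by
  rw [expectJ_eq]
  exact div_nonneg (G.integral_mul_weightJ_nonneg hJ
    (isCompPos_fst ((isCompMonomial_cosProd A).mul (isCompMonomial_sinProd B)))) (G.partitionFnJ_pos J).le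

/-- **(A3), upper — the Dunlop–Kunz–Pfister–Vuillermot inequality: `⟨s_A t_B⟩_J ≤ ⟨s_A⟩_J ⟨t_B⟩_J`** for the
ferromagnetic plane rotator (`J ≥ 0`): the `x`- and `y`-components of the spins are negatively correlated.
Duplicate variables: `−(s_A)_− (t_B)_−` lies in the component cone.
[cite: BricmontFontaineLandau1977, Appendix Thm A2 (A3)] -/
theorem expectJ_cosProd_mul_sinProd_le (hJ : ∀ a, 0 ≤ J a) (A B : Multiset V) :
    G.expectJ J (fun θ => cosProd A θ * sinProd B θ) ≤ G.expectJ J (cosProd A) * G.expectJ J (sinProd B) := by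
  refine G.expectJ_mul_le_of_integral J (G.integral_mul_mul_weightJ_mul_le hJ (continuous_cosProd A)
    (continuous_sinProd B) ?_)
  have h := (isCompPos_dup_cosProd A).2.mul (isCompPos_dup_sinProd B).2
  simp only [neg_mul] at h
  exact h

end TheoremA2

/-! ## §3 Two sites: `⟨cos θ_x cos θ_y⟩`, `⟨sin θ_x sin θ_y⟩ ∈ [0, ⟨cos(θ_x − θ_y)⟩]` -/

section TwoSites

variable [MeasurableSpace Circle] [BorelSpace Circle] {J : ι → ℝ}

omit [DecidableEq V] in
/-- Additivity of `⟨·⟩_J` on continuous observables. [cite: BricmontFontaineLandau1977, Appendix Thm A2 — plumbing] -/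
theorem expectJ_add' (J : ι → ℝ) {f g : (V → Circle) → ℝ} (hf : Continuous f) (hg : Continuous g) :
    G.expectJ J (fun θ => f θ + g θ) = G.expectJ J f + G.expectJ J g := by
  rw [expectJ_eq, expectJ_eq, expectJ_eq, ← add_div]
  congr 1
  have i1 : Integrable (fun θ => f θ * G.weightJ J θ) (torusHaar V) :=
    integrable_torusHaar_of_continuous (hf.mul (G.continuous_weightJ J))
  have i2 : Integrable (fun θ => g θ * G.weightJ J θ) (torusHaar V) :=
    integrable_torusHaar_of_continuous (hg.mul (G.continuous_weightJ J))
  rw [← integral_add i1 i2]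
  exact integral_congr_ae (ae_of_all _ fun θ => by ring)

omit [DecidableEq V] in
/-- `⟨·⟩_J` of a difference of continuous observables. [cite: BricmontFontaineLandau1977, Appendix Thm A2 — plumbing] -/
theorem expectJ_sub' (J : ι → ℝ) {f g : (V → Circle) → ℝ} (hf : Continuous f) (hg : Continuous g) :
    G.expectJ J (fun θ => f θ - g θ) = G.expectJ J f - G.expectJ J g := by
  rw [expectJ_eq, expectJ_eq, expectJ_eq, ← sub_div]
  congr 1
  have i1 : Integrable (fun θ => f θ * G.weightJ J θ) (torusHaar V) :=
    integrable_torusHaar_of_continuous (hf.mul (G.continuous_weightJ J))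
  have i2 : Integrable (fun θ => g θ * G.weightJ J θ) (torusHaar V) :=
    integrable_torusHaar_of_continuous (hg.mul (G.continuous_weightJ J))
  rw [← integral_sub i1 i2]
  exact integral_congr_ae (ae_of_all _ fun θ => by ring)

omit [DecidableEq V] in
/-- `⟨cos(θ_y − θ_x)⟩ = ⟨cos θ_x cos θ_y⟩ + ⟨sin θ_x sin θ_y⟩`. [cite: BricmontFontaineLandau1977, Appendix Thm A2 — plumbing] -/
theorem expectJ_reChar_diffChar_eq_components (J : ι → ℝ) (x y : V) :
    G.expectJ J (reChar (diffChar x y)) =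
      G.expectJ J (fun θ => spinRe x θ * spinRe y θ) + G.expectJ J (fun θ => spinIm x θ * spinIm y θ) := by
  rw [← G.expectJ_add' J (by fun_prop) (by fun_prop)]
  congr 1
  funext θ
  exact reChar_diffChar_eq_components x y θ

/-- `0 ≤ ⟨cos θ_x cos θ_y⟩_J` (`J ≥ 0`). [cite: BricmontFontaineLandau1977, Appendix Thm A2 (A3) with B = ∅] -/
theorem expectJ_spinRe_mul_spinRe_nonneg (hJ : ∀ a, 0 ≤ J a) (x y : V) :
    0 ≤ G.expectJ J (fun θ => spinRe x θ * spinRe y θ) := by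
  have h := G.expectJ_cosProd_mul_sinProd_nonneg hJ {x, y} 0
  simp only [cosProd_pair, sinProd_zero, mul_one] at h
  exact h

/-- `0 ≤ ⟨sin θ_x sin θ_y⟩_J` (`J ≥ 0`). [cite: BricmontFontaineLandau1977, Appendix Thm A2 (A3) with A = ∅] -/
theorem expectJ_spinIm_mul_spinIm_nonneg (hJ : ∀ a, 0 ≤ J a) (x y : V) :
    0 ≤ G.expectJ J (fun θ => spinIm x θ * spinIm y θ) := by
  have h := G.expectJ_cosProd_mul_sinProd_nonneg hJ 0 {x, y}
  simp only [cosProd_zero, sinProd_pair, one_mul] at h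
  exact h

/-- `0 ≤ ⟨cos(θ_y − θ_x)⟩_J` (`J ≥ 0`), in components. [cite: Ginibre1970, Example 4 (Griffiths' first inequality for plane rotators)] -/
theorem expectJ_reChar_diffChar_nonneg (hJ : ∀ a, 0 ≤ J a) (x y : V) :
    0 ≤ G.expectJ J (reChar (diffChar x y)) := by
  rw [G.expectJ_reChar_diffChar_eq_components J x y]
  exact add_nonneg (G.expectJ_spinRe_mul_spinRe_nonneg hJ x y) (G.expectJ_spinIm_mul_spinIm_nonneg hJ x y)

/-- `⟨cos θ_x cos θ_y⟩_J ≤ ⟨cos(θ_y − θ_x)⟩_J` (`J ≥ 0`). [cite: BricmontFontaineLandau1977, Appendix Thm A2 (A3)] -/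
theorem expectJ_spinRe_mul_spinRe_le (hJ : ∀ a, 0 ≤ J a) (x y : V) :
    G.expectJ J (fun θ => spinRe x θ * spinRe y θ) ≤ G.expectJ J (reChar (diffChar x y)) := by
  rw [G.expectJ_reChar_diffChar_eq_components J x y]
  have := G.expectJ_spinIm_mul_spinIm_nonneg hJ x y
  linarith

/-- `⟨sin θ_x sin θ_y⟩_J ≤ ⟨cos(θ_y − θ_x)⟩_J` (`J ≥ 0`). [cite: BricmontFontaineLandau1977, Appendix Thm A2 (A3)] -/
theorem expectJ_spinIm_mul_spinIm_le (hJ : ∀ a, 0 ≤ J a) (x y : V) :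
    G.expectJ J (fun θ => spinIm x θ * spinIm y θ) ≤ G.expectJ J (reChar (diffChar x y)) := by
  rw [G.expectJ_reChar_diffChar_eq_components J x y]
  have := G.expectJ_spinRe_mul_spinRe_nonneg hJ x y
  linarith

/-- The mixed pair term: `0 ≤ ⟨cos θ_x cos θ_y · sin θ_u sin θ_v⟩_J ≤ ⟨cos(θ_y − θ_x)⟩_J ⟨cos(θ_v − θ_u)⟩_J`
(`J ≥ 0`): (A3) for `A = {x,y}`, `B = {u,v}`, then §3. [cite: BricmontFontaineLandau1977, Appendix Thm A2 (A3)] -/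
theorem expectJ_pairTerm_mem_Icc (hJ : ∀ a, 0 ≤ J a) (x y u v : V) :
    G.expectJ J (fun θ => spinRe x θ * spinRe y θ * (spinIm u θ * spinIm v θ)) ∈
      Set.Icc 0 (G.expectJ J (reChar (diffChar x y)) * G.expectJ J (reChar (diffChar u v))) := by
  have h0 := G.expectJ_cosProd_mul_sinProd_nonneg hJ {x, y} {u, v}
  have h1 := G.expectJ_cosProd_mul_sinProd_le hJ {x, y} {u, v}
  have ec : (cosProd {x, y} : (V → Circle) → ℝ) = fun θ => spinRe x θ * spinRe y θ :=
    funext fun θ => cosProd_pair x y θ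
  have es : (sinProd {u, v} : (V → Circle) → ℝ) = fun θ => spinIm u θ * spinIm v θ :=
    funext fun θ => sinProd_pair u v θ
  simp only [ec, es] at h0 h1
  refine ⟨h0, h1.trans ?_⟩
  exact mul_le_mul (G.expectJ_spinRe_mul_spinRe_le hJ x y) (G.expectJ_spinIm_mul_spinIm_le hJ u v)
    (G.expectJ_spinIm_mul_spinIm_nonneg hJ u v) (G.expectJ_reChar_diffChar_nonneg hJ x y)

end TwoSites

/-! ## §4 Decoupling of two bond currents -/

section Currents

variable [MeasurableSpace Circle] [BorelSpace Circle] {J : ι → ℝ}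

/-- **Decoupling of two bond currents by the component inequalities.** For the ferromagnetic plane rotator
(`J ≥ 0`) and ANY four sites `a, a', c, c'`, with `G(x,y) = ⟨cos(θ_y − θ_x)⟩_J`:
`|⟨sin(θ_{a'} − θ_a) · sin(θ_{c'} − θ_c)⟩_J| ≤ 2·(G(a,c) G(a',c') + G(a,c') G(a',c))`.
Proof: `sin(θ_{a'} − θ_a) sin(θ_{c'} − θ_c) = s_{ac}t_{a'c'} − s_{ac'}t_{a'c} − s_{a'c}t_{ac'} + s_{a'c'}t_{ac}` in
components (`s_{xy} = cos θ_x cos θ_y`, `t_{uv} = sin θ_u sin θ_v`), and each `⟨s t⟩ ∈ [0, G·G]` by (A3). So the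
current–current correlation of two bonds is as small as the SQUARE of the two-point function between their
endpoints. [cite: BricmontFontaineLandau1977, Appendix Thm A2 (A3) (applied to the four component terms)] -/
theorem abs_expectJ_imChar_mul_imChar_le (hJ : ∀ a, 0 ≤ J a) (a a' c c' : V) :
    |G.expectJ J (fun θ => imChar (diffChar a a') θ * imChar (diffChar c c') θ)| ≤
      2 * (G.expectJ J (reChar (diffChar a c)) * G.expectJ J (reChar (diffChar a' c')) +
        G.expectJ J (reChar (diffChar a c')) * G.expectJ J (reChar (diffChar a' c))) := by
  -- the four component terms
  set T1 : (V → Circle) → ℝ := fun θ => spinRe a θ * spinRe c θ * (spinIm a' θ * spinIm c' θ) with hT1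
  set T2 : (V → Circle) → ℝ := fun θ => spinRe a θ * spinRe c' θ * (spinIm a' θ * spinIm c θ) with hT2
  set T3 : (V → Circle) → ℝ := fun θ => spinRe a' θ * spinRe c θ * (spinIm a θ * spinIm c' θ) with hT3
  set T4 : (V → Circle) → ℝ := fun θ => spinRe a' θ * spinRe c' θ * (spinIm a θ * spinIm c θ) with hT4
  have hc1 : Continuous T1 := by rw [hT1]; fun_prop
  have hc2 : Continuous T2 := by rw [hT2]; fun_prop
  have hc3 : Continuous T3 := by rw [hT3]; fun_prop
  have hc4 : Continuous T4 := by rw [hT4]; fun_prop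
  have hexp : (fun θ => imChar (diffChar a a') θ * imChar (diffChar c c') θ) =
      fun θ => ((T1 θ - T2 θ) - T3 θ) + T4 θ := by
    funext θ
    rw [imChar_diffChar_eq_components, imChar_diffChar_eq_components, hT1, hT2, hT3, hT4]
    ring
  have e1 : G.expectJ J (fun θ => ((T1 θ - T2 θ) - T3 θ) + T4 θ) =
      G.expectJ J (fun θ => (T1 θ - T2 θ) - T3 θ) + G.expectJ J T4 :=
    G.expectJ_add' J ((hc1.sub hc2).sub hc3) hc4
  have e2 : G.expectJ J (fun θ => (T1 θ - T2 θ) - T3 θ) = G.expectJ J (fun θ => T1 θ - T2 θ) - G.expectJ J T3 :=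
    G.expectJ_sub' J (hc1.sub hc2) hc3
  have e3 : G.expectJ J (fun θ => T1 θ - T2 θ) = G.expectJ J T1 - G.expectJ J T2 := G.expectJ_sub' J hc1 hc2
  rw [hexp, e1, e2, e3]
  obtain ⟨h1l, h1u⟩ := G.expectJ_pairTerm_mem_Icc hJ a c a' c'
  obtain ⟨h2l, h2u⟩ := G.expectJ_pairTerm_mem_Icc hJ a c' a' c
  obtain ⟨h3l, h3u⟩ := G.expectJ_pairTerm_mem_Icc hJ a' c a c'
  obtain ⟨h4l, h4u⟩ := G.expectJ_pairTerm_mem_Icc hJ a' c' a c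
  rw [abs_le]
  constructor
  · nlinarith [mul_comm (G.expectJ J (reChar (diffChar a' c))) (G.expectJ J (reChar (diffChar a c')))]
  · nlinarith [mul_comm (G.expectJ J (reChar (diffChar a' c'))) (G.expectJ J (reChar (diffChar a c)))]

/-- The same with the tree's two-point observable `cosDiff`: `|⟨sin∇θ_{aa'} sin∇θ_{cc'}⟩_J| ≤
2(⟨cos(θ_a−θ_c)⟩⟨cos(θ_{a'}−θ_{c'})⟩ + ⟨cos(θ_a−θ_{c'})⟩⟨cos(θ_{a'}−θ_c)⟩)`. [cite: BricmontFontaineLandau1977, Appendix Thm A2 (A3)] -/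
theorem abs_expectJ_imChar_mul_imChar_le_cosDiff (hJ : ∀ a, 0 ≤ J a) (a a' c c' : V) :
    |G.expectJ J (fun θ => imChar (diffChar a a') θ * imChar (diffChar c c') θ)| ≤
      2 * (G.expectJ J (cosDiff a c) * G.expectJ J (cosDiff a' c') +
        G.expectJ J (cosDiff a c') * G.expectJ J (cosDiff a' c)) := by
  have h := G.abs_expectJ_imChar_mul_imChar_le hJ a a' c c'
  have e : ∀ x y : V, (cosDiff x y : (V → Circle) → ℝ) = reChar (diffChar x y) :=
    fun x y => funext fun θ => cosDiff_eq_reChar x y θ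
  simp only [e]
  exact h

end Currents

end BondSystem

end Literature.Probability.LatticeModels
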